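import Mathlib

/-!
# `Balaban1983to89.B8Ineq199Assembly` — B8 p. 93 l. 1–4: the three-term bookkeeping behind (1.99)
# «|R𝔉₄(λ, Dλ, A, D\*A)| ≦ C′₄B₁(α₀ + α₁)α₄(Lʲη)⁻² on Ω_j», kernel-checked as norm arithmetic with the PRINTED inputs
# (1.96)–(1.98), (1.97), (1.92) (+ its Δ-entry), (1.121), (1.69) as named hypotheses, constant C′₄ EXPLICIT

statement-level skeleton of published theorems with citation tags; proofs where landed; nothing here is a claim
about the Yang–Mills mass gap

CITATION HEADER (lean-in-tree rule 2026-08-18; mega-formalization `lit-balaban`, reader/typer seat r05 gen 13, free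
target under protocol G.5-34(d); SKELETON row `B8.Eq1.99` = (1.97)–(1.99)).  T. Bałaban, *Spaces of regular gauge field
configurations on a lattice and gauge fixing conditions*, Commun. Math. Phys. **99** (1985) 75–102
`[Balaban1985RegularSpaces]` ("B8"; held `paper:balaban1985-cmp99-regular-spaces-gauge-fixing`, journal page = PDF page +
74), read on the page renders `…-p018-x2.png` (p. 92) and `…-p019-x2.png` (p. 93) and the text layer pp. 16, 18–20, 22:
p. 92 [PDF 18]: «This change of variables applied to Eqs. (1.90) gives the following equations
Rg(i ad_{λ−H′D′(u₁,λ)})Δ(λ − H′D′(u₁, λ)) − R exp(−i ad_{λ−H′D′(u₁,λ)})D\*A − R𝔉₃(λ − H′D′(u₁, λ), Dλ − DH′D′(u₁, λ), A) = 0,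
Q′λ = 0. (1.93)»; «Multiplying Eq. (1.93) by an inverse operator we obtain the equations Δλ − RD\*A − R𝔉₄(λ, Dλ, A, D\*A) =
0, Q′λ = 0. (1.95)»; «(I + RVR)⁻¹ = I + Σ_{n=1}^∞ (−1)ⁿ(RVR)ⁿ (1.96)»; (1.97) «= O(1)B₁(α₀ + α₁)α₄(Lʲη)⁻². Thus it is a
function with a bounded norm |·|₍₋₂₎»; «|Rf|₍₋₂₎ ≦ B′₀|f|₍₋₂₎, |Vf|₍₋₂₎ ≦ O(α₄)|f|₍₋₂₎. (1.98)»; «The function D′(u₁, λ) is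
… bounded by C′₂(α₃ + α₄)α₄, and also by (1/2B′₀)α₄» (= (1.121) p. 96); p. 93 [PDF 19] l. 1–4, verbatim: «This and (1.96)
implies that the operator (I + RVR)⁻¹ applied to the last term in (1.93) gives a term bounded by O(1)B₁(α₀ + α₁)α₄(Lʲη)⁻² on
Ω_j. We get the same bound for the term with D\*A (but with RD\*A subtracted), and with ΔH′D′(u₁, λ). Thus we have the
bound |R𝔉₄(λ, Dλ, A, D\*A)| ≦ C′₄B₁(α₀ + α₁)α₄(Lʲη)⁻² on Ω_j (1.99) for j < k.»; p. 90 [PDF 16] l. 8: «we keep the same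
meaning of α₃ as before (i.e. α₃ = 16dB₁(α₀ + α₁))»; p. 94 [PDF 20] l. 17–18: «To get best bounds on the solution we have
to take a smallest possible α₄, hence α₄ = 8B′₀B₁(α₀ + α₁)»; (1.69) p. 88: «|∇^η_{U₀}A| < B₁(α₀ + α₁)(Lʲη)⁻² on Ω_j».

STATUS IN THE TREE BEFORE THIS FILE (read first; nothing below restates it).  (1.99) is a NAMED HYPOTHESIS of the
Sect. D certification: `B8SectDSource.propFive_fixedPoint`/`propFive_choice`/`propFive_source` take «Φ = R𝔉₄ analytic with
(1.99) on the domain (1.102)» (`hΦ`).  Its printed inputs are in the tree: (1.96) `B8SectDSource.inverse_one_add_eq_tsum`,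
`norm_inverse_one_add_apply_sub_le`; (1.97) and the (1.98) V-half `B8Ineq197.ineq197_norm`/`ineq198_local` (r05 g5); the
(1.98) R-half `B8Ineq198R.ineq198_R` (r05 g13); (1.92) `B8Ineq192` and, with the un-displayed Δ-entry |ΔH′X|₍₋₂₎ ≦ B′₀|X|,
`B8Ineq192Op.ineq192_blocks_op` (r05 g13); the D′-bound (1.121) `B8SectEStatements.Dprime_bound` (abstract) /
`B8Eq1117Concrete` (p05); GAPS G-B8-19 (a) located the carried term −R g(i ad)ΔH′D′(u₁,λ) (p40 g7, kernel record
`B8Eq194FirstTerm.firstTerm_eq`) and its r05 g13 ADDENDUM hand-checked the constants typed here.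

WHAT THIS FILE PROVES (Mathlib only; theorems only, 0 `def`, 0 new facts, 0 sorry).  Over a normed field 𝕜 and normed
𝕜-spaces `F` (B8: site functions with the norm |·|₍₋₂₎ on Ω_{<k}) and `S` (B8: coarse functions X on 𝔅_k with the sup norm,
where D′(u₁, λ) lives), with continuous linear letters N = (I + RVR)⁻¹, R, E = exp(−i ad_{λ−H′D′}), g = g(i ad_{λ−H′D′}) on F
and ΔH′ : S → F, and elements f₃ = 𝔉₃(λ − H′D′, …) ∈ F, a = D\*A ∈ F, D′ ∈ S:
* `norm_sub_term_le` — the «(but with RD\*A subtracted)» step: N(R(Ea)) − Ra = (N − I)(R(Ea)) + R((E − I)a), so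
  ‖N(R(Ea)) − Ra‖ ≦ (c_N(1 + c_E) + c_E)·B′₀·α₄·‖a‖ from ‖Nx − x‖ ≦ c_Nα₄‖x‖ ((1.96) with θ = ‖RVR‖ = O(α₄)B′₀²),
  ‖Rx‖ ≦ B′₀‖x‖ ((1.98)), ‖Ex − x‖ ≦ c_Eα₄‖x‖ ((1.98) V-type), α₄ ≦ 1.
* **`ineq199_assembly`** — with R𝔉₄ := N(R(g(ΔH′D′))) + (N(R(Ea)) − Ra) + N(R f₃) (the three terms of p. 93 l. 1–3, read
  off (1.93)/(1.95)), the hypotheses above, ‖N‖-type bound ‖Nx‖ ≦ 2‖x‖ (θ ≦ ½), ‖gx‖ ≦ (1 + c_gα₄)‖x‖, the Δ-entry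
  ‖ΔH′X‖ ≦ B_Δ‖X‖, (1.121) ‖D′‖ ≦ C′₂(α₃ + α₄)α₄ with α₃ = 16dB₁s (s = α₀ + α₁), (1.97) ‖f₃‖ ≦ c₃B₁sα₄, (1.69)
  ‖a‖ ≦ c_AB₁s, and the SIDE CONDITION α₄ ≦ κ·B₁s:
  ‖R𝔉₄‖ ≦ C′₄·B₁s·α₄ with **C′₄ = 2B′₀(1 + c_g)B_ΔC′₂(16d + κ) + B′₀c_A(c_N(1 + c_E) + c_E) + 2B′₀c₃** — (1.99) in the norm
  |·|₍₋₂₎ (its pointwise form «on Ω_j» is the definition of that norm, `B8ScaledSupNorm.norm_le_of_msup_le`).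
* `ineq199_at_choice` — at the p. 94 choice α₄ = 8B′₀B₁s the side condition holds with κ = 8B′₀, so (1.99) holds there
  with C′₄(κ = 8B′₀) — the constant the existence clause (1.107)–(1.108) actually uses.

HONEST SCOPE / NOT CLAIMED.  (i) Norm arithmetic only: every analytic input is a hypothesis OF PRINTED SHAPE named after
its display ((1.96), (1.97), (1.98), (1.92)+Δ, (1.121), (1.69)); the identification of the letters with B8's lattice
operators and of F with the |·|₍₋₂₎-functions is the reader's (as in `B8SectDSource`).  (ii) LOCATED READING (GAPS G-B8-19
(a) ADDENDUM, r05 g13): with the Sect. E bound ‖D′‖ ≦ C′₂(α₃ + α₄)α₄ the ΔH′D′-term is O(B₁sα₄) exactly when α₄ ≦ O(1)·α₃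
— the hypothesis `hκ : α₄ ≤ κ * (B₁ * s)`; print fixes α₄ = 8B′₀B₁(α₀ + α₁) on p. 94 (κ = 8B′₀, `ineq199_at_choice`), so
(1.99)'s «C′₄» is uniform there; for the «α₄ sufficiently small, but otherwise arbitrary» of (1.77) the constant depends on
α₄/(B₁s).  Not an error of the paper; constants only.  (iii) Analyticity of R𝔉₄ in λ (used in (1.104)–(1.106)) is not
addressed here (`B8SectDSource` §2–§3, `B8Eq1117Analytic`).  NOTHING of the series' end-statement is asserted; value =
the last undisplayed arithmetic of row B8.Eq1.99 kernel-checked with its side condition exposed, NOT summit progress.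

RELATED IN THE TREE, NOT DUPLICATED (searched 2026-08-21T23:15Z: `ls Balaban1983to89/ | grep -i 199` = B15Bounds199,
B15Layer199Lattice, B5Eq199QGQTorus, B5QGQ199Rate, B7Ineq199General (other papers); `grep Ineq199 FILED.md` = B7 only):
`B8SectDSource.ineq1101` ((1.101), the next arithmetic step, consumes (1.99)), `B8Prop5Repaired.*`, `B8Ineq197`, `B8Ineq198R`,
`B8Ineq192Op`, `B8Eq194FirstTerm` — none assembles (1.99).
-/

namespace Literature.MathematicalPhysics.QuantumFieldTheory.Balaban1983to89.B8Ineq199Assembly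

variable {𝕜 : Type*} [NontriviallyNormedField 𝕜] {F S : Type*} [NormedAddCommGroup F] [NormedSpace 𝕜 F]
  [NormedAddCommGroup S] [NormedSpace 𝕜 S]

/-- Elementary: an operator bound `‖Tx‖ ≤ c‖x‖` composed with `‖x‖ ≤ A` (`c ≥ 0`). [folklore] -/
private theorem apply_le {E₁ E₂ : Type*} [NormedAddCommGroup E₁] [NormedSpace 𝕜 E₁] [NormedAddCommGroup E₂]
    [NormedSpace 𝕜 E₂] {T : E₁ →L[𝕜] E₂} {c A : ℝ} (hc : 0 ≤ c) (hT : ∀ x, ‖T x‖ ≤ c * ‖x‖) {x : E₁}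
    (hx : ‖x‖ ≤ A) : ‖T x‖ ≤ c * A :=
  (hT x).trans (mul_le_mul_of_nonneg_left hx hc)

/-- **«the term with D\*A (but with RD\*A subtracted)»** (p. 93 l. 2–3).  With N = (I + RVR)⁻¹, E = exp(−i ad_{λ−H′D′}),
a = D\*A: N(R(Ea)) − Ra = (N − I)(R(Ea)) + R((E − I)a), hence from ‖Nx − x‖ ≦ c_Nα₄‖x‖ ((1.96): ‖(I + T)⁻¹x − x‖ ≦
θ(1 − θ)⁻¹‖x‖ with θ = ‖RVR‖ = O(α₄)B′₀², `B8SectDSource.norm_inverse_one_add_apply_sub_le`), ‖Rx‖ ≦ B′₀‖x‖ ((1.98) R-half),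
‖Ex − x‖ ≦ c_Eα₄‖x‖ (the exponential of O(α₄), (1.98) V-type) and α₄ ≦ 1:
‖N(R(Ea)) − Ra‖ ≦ (c_N(1 + c_E) + c_E)·B′₀·α₄·‖a‖. [cite: Balaban1985RegularSpaces, p.93 l.2–3; (1.93), (1.95), (1.96), (1.98) p.92] -/
theorem norm_sub_term_le (N R E : F →L[𝕜] F) (a : F) (B₀' cN cE α₄ : ℝ) (hB : 0 ≤ B₀') (hcN : 0 ≤ cN)
    (hcE : 0 ≤ cE) (hα₄ : 0 ≤ α₄) (hα₄1 : α₄ ≤ 1)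
    (hN : ∀ x, ‖N x - x‖ ≤ cN * α₄ * ‖x‖) (hR : ∀ x, ‖R x‖ ≤ B₀' * ‖x‖)
    (hE : ∀ x, ‖E x - x‖ ≤ cE * α₄ * ‖x‖) :
    ‖N (R (E a)) - R a‖ ≤ (cN * (1 + cE) + cE) * B₀' * α₄ * ‖a‖ := by
  -- ‖Ea‖ ≤ (1 + c_E α₄)‖a‖ ≤ (1 + c_E)‖a‖
  have hEa : ‖E a‖ ≤ (1 + cE) * ‖a‖ := by
    have h1 : ‖E a‖ ≤ ‖E a - a‖ + ‖a‖ := by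
      calc ‖E a‖ = ‖(E a - a) + a‖ := by rw [sub_add_cancel]
        _ ≤ ‖E a - a‖ + ‖a‖ := norm_add_le _ _
    have h2 : cE * α₄ * ‖a‖ ≤ cE * ‖a‖ := by
      have := mul_le_mul_of_nonneg_left hα₄1 hcE
      calc cE * α₄ * ‖a‖ ≤ cE * 1 * ‖a‖ := by gcongr
        _ = cE * ‖a‖ := by ring
    calc ‖E a‖ ≤ cE * α₄ * ‖a‖ + ‖a‖ := h1.trans (by linarith [hE a])
      _ ≤ cE * ‖a‖ + ‖a‖ := by linarith
      _ = (1 + cE) * ‖a‖ := by ring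
  have hREa : ‖R (E a)‖ ≤ B₀' * ((1 + cE) * ‖a‖) := apply_le hB hR hEa
  -- the splitting N(R(Ea)) − Ra = (N(R(Ea)) − R(Ea)) + R(Ea − a)
  have hsplit : N (R (E a)) - R a = (N (R (E a)) - R (E a)) + R (E a - a) := by
    rw [map_sub]; abel
  have t1 : ‖N (R (E a)) - R (E a)‖ ≤ cN * α₄ * (B₀' * ((1 + cE) * ‖a‖)) :=
    (hN _).trans (mul_le_mul_of_nonneg_left hREa (mul_nonneg hcN hα₄))
  have t2 : ‖R (E a - a)‖ ≤ B₀' * (cE * α₄ * ‖a‖) := apply_le hB hR (hE a)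
  calc ‖N (R (E a)) - R a‖ = ‖(N (R (E a)) - R (E a)) + R (E a - a)‖ := by rw [hsplit]
    _ ≤ ‖N (R (E a)) - R (E a)‖ + ‖R (E a - a)‖ := norm_add_le _ _
    _ ≤ cN * α₄ * (B₀' * ((1 + cE) * ‖a‖)) + B₀' * (cE * α₄ * ‖a‖) := add_le_add t1 t2
    _ = (cN * (1 + cE) + cE) * B₀' * α₄ * ‖a‖ := by ring

/-- **p. 93 l. 1–4 ⇒ (1.99), the constant C′₄ explicit.**  Terms of R𝔉₄ read off (1.93)/(1.95): T₁ = N(R(g(ΔH′D′)))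
(«and with ΔH′D′(u₁, λ)»), T₂ = N(R(Ea)) − Ra («the term with D\*A (but with RD\*A subtracted)»), T₃ = N(R f₃) («the operator
(I + RVR)⁻¹ applied to the last term in (1.93)»).  PRINTED-SHAPE INPUTS: ‖Nx‖ ≦ 2‖x‖ and ‖Nx − x‖ ≦ c_Nα₄‖x‖ ((1.96),
θ = O(α₄)B′₀² ≦ ½), ‖Rx‖ ≦ B′₀‖x‖ ((1.98)), ‖Ex − x‖ ≦ c_Eα₄‖x‖ and ‖gx‖ ≦ (1 + c_gα₄)‖x‖ ((1.98) V-type: g(i ad) − 1,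
e^{−i ad} − 1 = O(α₄)), the Δ-entry of (1.92) ‖ΔH′X‖ ≦ B_Δ‖X‖ (`B8Ineq192Op`), (1.121) ‖D′‖ ≦ C′₂(α₃ + α₄)α₄ with
α₃ = 16dB₁s (p. 90), (1.97) ‖f₃‖ ≦ c₃B₁sα₄, (1.69) ‖a‖ ≦ c_AB₁s (s = α₀ + α₁), 0 ≦ α₄ ≦ 1, and the SIDE CONDITION
α₄ ≦ κB₁s (located, G-B8-19 (a) addendum; print's choice p. 94 has κ = 8B′₀).  CONCLUSION:
‖T₁ + T₂ + T₃‖ ≦ C′₄·B₁s·α₄, **C′₄ = 2B′₀(1 + c_g)B_ΔC′₂(16d + κ) + B′₀c_A(c_N(1 + c_E) + c_E) + 2B′₀c₃** — (1.99) in the norm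
|·|₍₋₂₎. [cite: Balaban1985RegularSpaces, (1.99) p.93 l.1–4; (1.93), (1.95)–(1.98) p.92; (1.121) p.96; p.90 l.8 (α₃); (1.69) p.88] -/
theorem ineq199_assembly (N R E g : F →L[𝕜] F) (LapH : S →L[𝕜] F) (f₃ a : F) (Dp : S)
    (B₀' BΔ cN cE cg c₃ cA C₂' d κ α₃ α₄ B₁ s : ℝ)
    (hB : 0 ≤ B₀') (hBΔ : 0 ≤ BΔ) (hcN : 0 ≤ cN) (hcE : 0 ≤ cE) (hcg : 0 ≤ cg) (hC₂ : 0 ≤ C₂')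
    (hα₄ : 0 ≤ α₄) (hα₄1 : α₄ ≤ 1) (hκ : α₄ ≤ κ * (B₁ * s)) (hα₃ : α₃ = 16 * d * (B₁ * s))
    (hN2 : ∀ x, ‖N x‖ ≤ 2 * ‖x‖) (hN : ∀ x, ‖N x - x‖ ≤ cN * α₄ * ‖x‖) (hR : ∀ x, ‖R x‖ ≤ B₀' * ‖x‖)
    (hE : ∀ x, ‖E x - x‖ ≤ cE * α₄ * ‖x‖) (hg : ∀ x, ‖g x‖ ≤ (1 + cg * α₄) * ‖x‖)
    (hLapH : ∀ X, ‖LapH X‖ ≤ BΔ * ‖X‖) (hDp : ‖Dp‖ ≤ C₂' * (α₃ + α₄) * α₄)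
    (hf₃ : ‖f₃‖ ≤ c₃ * (B₁ * s) * α₄) (ha : ‖a‖ ≤ cA * (B₁ * s)) :
    ‖N (R (g (LapH Dp))) + (N (R (E a)) - R a) + N (R f₃)‖ ≤
      (2 * B₀' * (1 + cg) * BΔ * C₂' * (16 * d + κ) + B₀' * cA * (cN * (1 + cE) + cE) + 2 * B₀' * c₃) *
        (B₁ * s) * α₄ := by
  -- T₃: the 𝔉₃-term
  have t3 : ‖N (R f₃)‖ ≤ 2 * (B₀' * (c₃ * (B₁ * s) * α₄)) :=
    apply_le (by norm_num) hN2 (apply_le hB hR hf₃)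
  -- T₂: the D*A-term with RD*A subtracted
  have t2 := norm_sub_term_le N R E a B₀' cN cE α₄ hB hcN hcE hα₄ hα₄1 hN hR hE
  have t2' : ‖N (R (E a)) - R a‖ ≤ (cN * (1 + cE) + cE) * B₀' * α₄ * (cA * (B₁ * s)) :=
    t2.trans (mul_le_mul_of_nonneg_left ha (by positivity))
  -- T₁: the ΔH′D′-term; ‖D′‖ ≤ C′₂(α₃ + α₄)α₄ ≤ C′₂(16d + κ)B₁s·α₄ under the side condition
  have hsum : α₃ + α₄ ≤ (16 * d + κ) * (B₁ * s) := by rw [hα₃]; nlinarith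
  have hDp' : ‖Dp‖ ≤ C₂' * ((16 * d + κ) * (B₁ * s)) * α₄ := by
    refine hDp.trans ?_
    have := mul_le_mul_of_nonneg_left hsum hC₂
    exact mul_le_mul_of_nonneg_right this hα₄
  have hg' : ∀ x, ‖g x‖ ≤ (1 + cg) * ‖x‖ := fun x => by
    refine (hg x).trans (mul_le_mul_of_nonneg_right ?_ (norm_nonneg _))
    nlinarith
  have t1 : ‖N (R (g (LapH Dp)))‖ ≤ 2 * (B₀' * ((1 + cg) * (BΔ * (C₂' * ((16 * d + κ) * (B₁ * s)) * α₄)))) :=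
    apply_le (by norm_num) hN2 (apply_le hB hR (apply_le (by positivity) hg' (apply_le hBΔ hLapH hDp')))
  calc ‖N (R (g (LapH Dp))) + (N (R (E a)) - R a) + N (R f₃)‖
      ≤ ‖N (R (g (LapH Dp))) + (N (R (E a)) - R a)‖ + ‖N (R f₃)‖ := norm_add_le _ _
    _ ≤ (‖N (R (g (LapH Dp)))‖ + ‖N (R (E a)) - R a‖) + ‖N (R f₃)‖ := by
        gcongr; exact norm_add_le _ _
    _ ≤ (2 * (B₀' * ((1 + cg) * (BΔ * (C₂' * ((16 * d + κ) * (B₁ * s)) * α₄)))) +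
          (cN * (1 + cE) + cE) * B₀' * α₄ * (cA * (B₁ * s))) + 2 * (B₀' * (c₃ * (B₁ * s) * α₄)) :=
        add_le_add (add_le_add t1 t2') t3
    _ = (2 * B₀' * (1 + cg) * BΔ * C₂' * (16 * d + κ) + B₀' * cA * (cN * (1 + cE) + cE) + 2 * B₀' * c₃) *
          (B₁ * s) * α₄ := by ring

/-- **(1.99) at the paper's choice of α₄** (p. 94 l. 17–18 «hence α₄ = 8B′₀B₁(α₀ + α₁)»): the side condition of
`ineq199_assembly` holds with κ = 8B′₀, so ‖R𝔉₄‖ ≦ C′₄(8B′₀)·B₁s·α₄ with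
C′₄(8B′₀) = 2B′₀(1 + c_g)B_ΔC′₂(16d + 8B′₀) + B′₀c_A(c_N(1 + c_E) + c_E) + 2B′₀c₃ — «depending on d and L only» through the
constants of (1.92)/(1.96)–(1.98)/(1.121). [cite: Balaban1985RegularSpaces, (1.99) p.93; p.94 l.17–18] -/
theorem ineq199_at_choice (N R E g : F →L[𝕜] F) (LapH : S →L[𝕜] F) (f₃ a : F) (Dp : S)
    (B₀' BΔ cN cE cg c₃ cA C₂' d α₃ α₄ B₁ s : ℝ)
    (hB : 0 ≤ B₀') (hBΔ : 0 ≤ BΔ) (hcN : 0 ≤ cN) (hcE : 0 ≤ cE) (hcg : 0 ≤ cg) (hC₂ : 0 ≤ C₂')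
    (hB₁s : 0 ≤ B₁ * s) (hα₄1 : α₄ ≤ 1) (hchoice : α₄ = 8 * B₀' * (B₁ * s)) (hα₃ : α₃ = 16 * d * (B₁ * s))
    (hN2 : ∀ x, ‖N x‖ ≤ 2 * ‖x‖) (hN : ∀ x, ‖N x - x‖ ≤ cN * α₄ * ‖x‖) (hR : ∀ x, ‖R x‖ ≤ B₀' * ‖x‖)
    (hE : ∀ x, ‖E x - x‖ ≤ cE * α₄ * ‖x‖) (hg : ∀ x, ‖g x‖ ≤ (1 + cg * α₄) * ‖x‖)
    (hLapH : ∀ X, ‖LapH X‖ ≤ BΔ * ‖X‖) (hDp : ‖Dp‖ ≤ C₂' * (α₃ + α₄) * α₄)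
    (hf₃ : ‖f₃‖ ≤ c₃ * (B₁ * s) * α₄) (ha : ‖a‖ ≤ cA * (B₁ * s)) :
    ‖N (R (g (LapH Dp))) + (N (R (E a)) - R a) + N (R f₃)‖ ≤
      (2 * B₀' * (1 + cg) * BΔ * C₂' * (16 * d + 8 * B₀') + B₀' * cA * (cN * (1 + cE) + cE) + 2 * B₀' * c₃) *
        (B₁ * s) * α₄ := by
  have hα₄ : 0 ≤ α₄ := by rw [hchoice]; positivity
  have hκ : α₄ ≤ 8 * B₀' * (B₁ * s) := le_of_eq hchoice
  exact ineq199_assembly N R E g LapH f₃ a Dp B₀' BΔ cN cE cg c₃ cA C₂' d (8 * B₀') α₃ α₄ B₁ s hB hBΔ hcN hcE hcg hC₂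
    hα₄ hα₄1 hκ hα₃ hN2 hN hR hE hg hLapH hDp hf₃ ha

end Literature.MathematicalPhysics.QuantumFieldTheory.Balaban1983to89.B8Ineq199Assembly
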